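import Literature.InformationTheory.Entropy.ConditionalEntropyConcavity
import HarnessLib

/-!
# Concavity of the von Neumann entropy: `Σ_x p_x S(ρ_x) ≤ S(Σ_x p_x ρ_x)`

Topic `Literature/InformationTheory/Entropy` (namespace = path). The von Neumann entropy is a concave function of
the density operator [cite: NielsenChuang2010, Theorem 11.10 eq. (11.87) p.517] («S(Σ_i p_i ρ_i) ≥ Σ_i p_i S(ρ_i)»),
[cite: LiebRuskai1973, Theorem 1 and §III (A)]. In the tree the STRONGER concavity of the conditional entropy
`ρ_{AB} ↦ S(ρ_{AB}) − S(Tr_A ρ_{AB})` is proved (`convexComb_vonNeumannEntropy_sub_traceLeft_le`,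
`ConditionalEntropyConcavity.lean`, from strong subadditivity); this file records the one-system corollary, obtained by
attaching a trivial (one-dimensional) second system `B = Unit`, on which every marginal is the SAME `1 × 1` density so
that the conditional terms cancel — no spectral computation on `Unit` is needed:

* `vonNeumannEntropy_convexComb_ge` — for density matrices `ρ_x` (`x ∈ X` finite) on a finite index type `n`
  (both in `Type`, as the strong-subadditivity chain they rest on) and a probability vector `p`:
  `Σ_x p_x S(ρ_x) ≤ S(Σ_x p_x ρ_x)`;
* `vonNeumannEntropy_convexComb_two_ge` — the two-point form `(1−t) S(ρ) + t S(τ) ≤ S((1−t)ρ + tτ)`, `t ∈ [0,1]`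
  (e.g. the faithful regularisation `(1−δ)σ + δ·𝟙/D` of a singular trial state loses at most the fraction `δ` of
  its entropy: `(1−δ) S(σ) ≤ S((1−δ)σ + δ𝟙/D)`).

Everything is PROVED; no definition, no named fact.

## Tree / Mathlib search

REUSED: `convexComb_vonNeumannEntropy_sub_traceLeft_le`, `vonNeumannEntropy_submatrix_equiv`, `IsDensity`,
`traceLeft(_apply)` (`ConditionalEntropyConcavity`, `VonNeumannEntropyInequalities`, `QuantumMarginals`);
`vonNeumannEntropy_nonneg`. `lean search 'concav.*vonNeumannEntropy|vonNeumannEntropy_convex'`: nothing (2026-08-27) —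
only the classical `concaveOn_entropy` (`NonparametricDistributionEstimation`) and Mathlib's `strictConcave_binEntropy`.
-/

namespace Literature.InformationTheory.Entropy

open Matrix
open scoped BigOperators ComplexOrder

open Literature.Computability.QuantumComplexity (traceLeft IsDensity traceLeft_apply)

section Concavity

variable {n X : Type} [Fintype n] [DecidableEq n] [Fintype X] [DecidableEq X]

omit [DecidableEq n] [Fintype X] [DecidableEq X] in
/-- Attaching a one-dimensional system: `ρ ↦ ρ ⊗ 1_{Unit}` as a matrix on `n × Unit`. The partial trace over `n` of the
image of ANY matrix of trace `c` is the `1 × 1` matrix `c` — so all densities have the same `Unit` marginal.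
[cite: NielsenChuang2010, Theorem 11.10 eq. (11.87) p.517] -/
theorem traceLeft_submatrix_prodUnique (ρ : Matrix n n ℂ) :
    traceLeft (ρ.submatrix (Equiv.prodUnique n Unit) (Equiv.prodUnique n Unit)) =
      ρ.trace • (1 : Matrix Unit Unit ℂ) := by
  ext b b'
  obtain rfl : b = b' := Subsingleton.elim _ _
  rw [traceLeft_apply]
  simp [Matrix.trace]

omit [DecidableEq n] [Fintype X] [DecidableEq X] in
/-- Trace is invariant under relabelling by a bijection. [cite: NielsenChuang2010, Theorem 11.10 eq. (11.87) p.517] -/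
theorem trace_submatrix_equiv_eq {m : Type} [Fintype m] (M : Matrix n n ℂ) (e : m ≃ n) :
    (M.submatrix e e).trace = M.trace := by
  simp only [Matrix.trace, Matrix.diag, Matrix.submatrix_apply]
  exact e.sum_comp (fun j => M j j)

/-- **Concavity of the von Neumann entropy**: `Σ_x p_x S(ρ_x) ≤ S(Σ_x p_x ρ_x)` for density matrices `ρ_x` and a
probability vector `p`. [cite: NielsenChuang2010, Theorem 11.10 eq. (11.87) p.517] [cite: LiebRuskai1973, Theorem 1] -/
theorem vonNeumannEntropy_convexComb_ge (p : X → ℝ) (hp : ∀ x, 0 ≤ p x) (hp1 : ∑ x, p x = 1)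
    (ρ : X → Matrix n n ℂ) (hρ : ∀ x, IsDensity (ρ x)) :
    ∑ x, p x * vonNeumannEntropy (ρ x) ≤ vonNeumannEntropy (∑ x, (p x : ℂ) • ρ x) := by
  set e := Equiv.prodUnique n Unit with he
  -- the lifted densities on `n × Unit`
  set ρ' : X → Matrix (n × Unit) (n × Unit) ℂ := fun x => (ρ x).submatrix e e with hρ'
  have hρ'd : ∀ x, IsDensity (ρ' x) := fun x =>
    ⟨(hρ x).1.submatrix e, by rw [hρ']; dsimp only; rw [trace_submatrix_equiv_eq, (hρ x).2]⟩
  have key := convexComb_vonNeumannEntropy_sub_traceLeft_le p hp hp1 ρ' hρ'd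
  -- the mixture, lifted
  have hsum : ∑ x, (p x : ℂ) • ρ' x = (∑ x, (p x : ℂ) • ρ x).submatrix e e := by
    ext i j
    simp [hρ', Matrix.sum_apply, Matrix.smul_apply, Matrix.submatrix_apply]
  have hp1c : ∑ x, (p x : ℂ) = 1 := by exact_mod_cast hp1
  have htr_sum : (∑ x, (p x : ℂ) • ρ x).trace = 1 := by
    rw [Matrix.trace_sum]
    simp only [Matrix.trace_smul, smul_eq_mul]
    rw [show ∑ x, (p x : ℂ) * (ρ x).trace = ∑ x, (p x : ℂ) from
      Finset.sum_congr rfl fun x _ => by rw [(hρ x).2, mul_one], hp1c]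
  -- every `Unit` marginal is the same `1 × 1` density
  have hmarg : ∀ x, traceLeft (ρ' x) = (1 : ℂ) • (1 : Matrix Unit Unit ℂ) := fun x => by
    rw [hρ']; dsimp only; rw [traceLeft_submatrix_prodUnique, (hρ x).2]
  have hmarg' : traceLeft (∑ x, (p x : ℂ) • ρ' x) = (1 : ℂ) • (1 : Matrix Unit Unit ℂ) := by
    rw [hsum, traceLeft_submatrix_prodUnique, htr_sum]
  -- entropies of the lifts
  have hS : ∀ x, vonNeumannEntropy (ρ' x) = vonNeumannEntropy (ρ x) := fun x => by
    rw [hρ']; exact vonNeumannEntropy_submatrix_equiv (hρ x).1.1 e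
  have hHerm : (∑ x, (p x : ℂ) • ρ x).IsHermitian := by
    unfold Matrix.IsHermitian
    rw [Matrix.conjTranspose_sum]
    refine Finset.sum_congr rfl fun x _ => ?_
    rw [Matrix.conjTranspose_smul, (hρ x).1.1.eq, Complex.star_def, Complex.conj_ofReal]
  have hS' : vonNeumannEntropy (∑ x, (p x : ℂ) • ρ' x) = vonNeumannEntropy (∑ x, (p x : ℂ) • ρ x) := by
    rw [hsum]; exact vonNeumannEntropy_submatrix_equiv hHerm e
  simp_rw [hmarg, hS] at key
  rw [hmarg', hS'] at key
  -- the conditional terms cancel (`Σ p_x = 1`)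
  set c := vonNeumannEntropy ((1 : ℂ) • (1 : Matrix Unit Unit ℂ)) with hc
  have hsplit : ∑ x, p x * (vonNeumannEntropy (ρ x) - c) = ∑ x, p x * vonNeumannEntropy (ρ x) - c := by
    simp only [mul_sub, Finset.sum_sub_distrib, ← Finset.sum_mul, hp1, one_mul]
  linarith [hsplit]

/-- **Two-point concavity**: `(1−t) S(ρ) + t S(τ) ≤ S((1−t)ρ + tτ)` for densities `ρ, τ` and `t ∈ [0,1]` — in particular
the faithful regularisation `σ_δ = (1−δ)σ + δ·𝟙/D` of a singular density satisfies `(1−δ) S(σ) ≤ S(σ_δ)`.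
[cite: NielsenChuang2010, Theorem 11.10 eq. (11.87) p.517] -/
theorem vonNeumannEntropy_convexComb_two_ge {t : ℝ} (ht0 : 0 ≤ t) (ht1 : t ≤ 1)
    {ρ τ : Matrix n n ℂ} (hρ : IsDensity ρ) (hτ : IsDensity τ) :
    (1 - t) * vonNeumannEntropy ρ + t * vonNeumannEntropy τ ≤
      vonNeumannEntropy (((1 - t : ℝ) : ℂ) • ρ + ((t : ℝ) : ℂ) • τ) := by
  have h := vonNeumannEntropy_convexComb_ge (X := Bool) (fun b => if b then t else 1 - t)
    (fun b => by cases b <;> simp [ht0, sub_nonneg.2 ht1]) (by simp) (fun b => if b then τ else ρ)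
    (fun b => by cases b <;> assumption)
  have hsum : ∑ b : Bool, (((if b then t else 1 - t : ℝ)) : ℂ) • (if b then τ else ρ) =
      ((1 - t : ℝ) : ℂ) • ρ + ((t : ℝ) : ℂ) • τ := by
    rw [Fintype.sum_bool]
    simp only [ite_true]
    rw [add_comm]
    rfl
  have hlhs : ∑ b : Bool, (if b then t else 1 - t) * vonNeumannEntropy (if b then τ else ρ) =
      (1 - t) * vonNeumannEntropy ρ + t * vonNeumannEntropy τ := by
    rw [Fintype.sum_bool]
    simp only [ite_true]
    rw [add_comm]
    rfl
  rw [hsum, hlhs] at h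
  exact h

end Concavity

/-! ### §2 Diagonal and maximally mixed states (append 2026-08-27, hubbard-thermal-p1 g6) -/

section Diagonal

variable {n : Type} [Fintype n] [DecidableEq n]

/-- **Entropy of a real diagonal matrix**: `S(diag d) = Σ_i η(d_i)` (`η(t) = −t log t`) — its characteristic polynomial is
`Π_i (X − d_i)`. [cite: NielsenChuang2010, §11.3 eq. (11.40)] -/
theorem vonNeumannEntropy_diagonal_ofReal (d : n → ℝ) :
    vonNeumannEntropy (Matrix.diagonal fun i => ((d i : ℝ) : ℂ)) = ∑ i, Real.negMulLog (d i) := by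
  have hH : (Matrix.diagonal fun i => ((d i : ℝ) : ℂ)).IsHermitian :=
    Matrix.isHermitian_diagonal_of_self_adjoint _ (funext fun i => by simp)
  rw [vonNeumannEntropy_eq_sum_roots_charpoly hH, Matrix.charpoly_diagonal]
  have hprod : (∏ i, (Polynomial.X - Polynomial.C ((d i : ℝ) : ℂ))) =
      ((Finset.univ.val.map fun i => ((d i : ℝ) : ℂ)).map fun a => Polynomial.X - Polynomial.C a).prod := by
    rw [Multiset.map_map, Finset.prod_eq_multiset_prod]
    rfl
  rw [hprod, Polynomial.roots_multiset_prod_X_sub_C, Multiset.map_map, ← Finset.sum_eq_multiset_sum]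
  simp

/-- The maximally mixed state `𝟙/|n|` is a density matrix (`n` nonempty). [cite: NielsenChuang2010, §11.3 eq. (11.40)] -/
theorem isDensity_uniform [Nonempty n] :
    IsDensity (((Fintype.card n : ℂ))⁻¹ • (1 : Matrix n n ℂ)) := by
  have hc : (0 : ℝ) < Fintype.card n := by exact_mod_cast Fintype.card_pos
  refine ⟨?_, ?_⟩
  · have h1 : (1 : Matrix n n ℂ).PosSemidef := Matrix.PosSemidef.one
    have hk : (0 : ℂ) ≤ ((Fintype.card n : ℂ))⁻¹ := by
      rw [← Complex.ofReal_natCast, ← Complex.ofReal_inv]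
      exact Complex.zero_le_real.2 (inv_nonneg.2 hc.le)
    exact h1.smul hk
  · rw [Matrix.trace_smul, Matrix.trace_one, smul_eq_mul, inv_mul_cancel₀]
    exact_mod_cast hc.ne'

/-- **Entropy of the maximally mixed state**: `S(𝟙/|n|) = log |n|`. [cite: NielsenChuang2010, §11.3 eq. (11.40); Theorem 11.8 (2) p.513] -/
theorem vonNeumannEntropy_uniform [Nonempty n] :
    vonNeumannEntropy (((Fintype.card n : ℂ))⁻¹ • (1 : Matrix n n ℂ)) = Real.log (Fintype.card n) := by
  have hc : (0 : ℝ) < Fintype.card n := by exact_mod_cast Fintype.card_pos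
  have hmat : ((Fintype.card n : ℂ))⁻¹ • (1 : Matrix n n ℂ) =
      Matrix.diagonal fun _ : n => (((Fintype.card n : ℝ)⁻¹ : ℝ) : ℂ) := by
    rw [Matrix.smul_one_eq_diagonal]
    congr 1
    funext i
    push_cast
    rfl
  rw [hmat, vonNeumannEntropy_diagonal_ofReal, Finset.sum_const, Finset.card_univ, nsmul_eq_mul,
    Real.negMulLog, Real.log_inv]
  field_simp

/-- **The faithful regularisation loses at most `δ·S(σ) − δ log|n|`**: for a density `σ` and `δ ∈ [0,1]`,
`(1−δ)·S(σ) + δ·log|n| ≤ S((1−δ)σ + δ·𝟙/|n|)`. [cite: NielsenChuang2010, Theorem 11.10 eq. (11.87) p.517] -/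
theorem vonNeumannEntropy_regularise_ge [Nonempty n] {δ : ℝ} (hδ0 : 0 ≤ δ) (hδ1 : δ ≤ 1) {σ : Matrix n n ℂ}
    (hσ : IsDensity σ) :
    (1 - δ) * vonNeumannEntropy σ + δ * Real.log (Fintype.card n) ≤
      vonNeumannEntropy (((1 - δ : ℝ) : ℂ) • σ + ((δ : ℝ) : ℂ) • (((Fintype.card n : ℂ))⁻¹ • (1 : Matrix n n ℂ))) := by
  have h := vonNeumannEntropy_convexComb_two_ge hδ0 hδ1 hσ (isDensity_uniform (n := n))
  rwa [vonNeumannEntropy_uniform] at h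

end Diagonal

end Literature.InformationTheory.Entropy
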